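import Summits.FinalStateConjecture.FinalStateConjecture.Theorems.PhotonSphereChannelsKerrDevDefs
import Literature.Geometry.Lorentzian.TameChartCompactnessUnoriented
import Literature.Geometry.Lorentzian.VacuumLocalLimit
import HarnessLib

/-!
# Route PhotonSphereChannels · crux `ChannelsResolveTameDevelopmentsR` (K2R-T2, stmt-FinalStateConjecture-17430),
# line `dark-future-exactness`, stub A `stub_silentHull` — the COMPACTNESS THIRD of clause (a):
# vacuum `C^∞_loc` limits exist along every sequence of an all-orders tame region

Stub A (`SilentHull`, skeleton `Cruxes/ChannelsResolveTameDevelopmentsR/Lines/dark_future_exactness.lean`)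
asks, for a development `𝒟` with `TameHull.DevHyp 𝒟`, for silent hull elements along every
future-escaping outer sequence `q`: a limit spacetime `𝓢`, an all-orders tame silent END `E` of `𝓢`, a base
point, and pointed `C²_loc` subconvergence `(𝒟, qₙ) ⇀ (𝓢, p)` (`Spacetime.SubconvergesLocallyTo`). Its
content splits as COMPACTNESS (a limit spacetime exists and is vacuum) + END STRUCTURE (eternal far chart and
clock on the limit) + SILENCE (Bondi / area budgets). This file proves the LOCAL (one tame ball) part of the
compactness third, over the landed vocabulary `TameHull.outerRegion` / `TameHull.IsFutureEscaping` and the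
local Cheeger–Gromov producers of `Literature/Geometry/Lorentzian/TameChartCompactness*.lean`,
`VacuumLocalLimit.lean`:

* `exists_nearMinkowskiChart_limit_of_tameAllOrders` — if every point of a region `S ⊆ 𝒟` is the centre of
  a late chart of the coordinate ball `B(0, r₀)` with `C⁰`-deviation `≤ 1/2` and `Cᵏ`-deviation `≤ Λ k` for
  EVERY `k` (the per-point clause of hypothesis (ii) `TameHull.TameOuter` of the crux, verbatim, with the
  order `3` replaced by all orders — the planners' restatement flagged as Finding G of TRIAGE-r2-3), then
  along every sequence `q` in `S` the pointed spacetimes `(𝒟, qₙ)` subconverge, in the pointed `Cᵏ_loc` sense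
  for every `k`, to the near-Minkowski chart spacetime of a smooth field `G` on the ball (time-oriented by
  `∂₀` or by `−∂₀`: the tame charts of (ii) carry no orientation), with `‖G − η‖ ≤ 1/2`,
  `sup_{Cᵏ} ‖G − η‖ ≤ Λ k`, and `G` RICCI-FLAT (vacuum passes to `C²` limits);
* `exists_vacuumLimit_of_tameAllOrders` — the packaged form `∃ 𝓢 p, Ric(𝓢) = 0 ∧ ∀ k, (𝒟, qₙ) ⇀ (𝓢, p)`;
* `exists_vacuumLimit_of_isFutureEscaping` — the same along every future-escaping OUTER sequence when the
  outer region is all-orders tame: exactly the limit clause of `IsSilentHullElement` (at every order, not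
  only `2`), the end and silence clauses being the remaining (typed, open) content of stub A.

Why all orders (the flag, made concrete): with the crux's (ii) as typed (`C³` bounds only) the same
Arzelà–Ascoli argument yields a `C²` limit FIELD (`ChartMetricCompactness.lean`), which is not a
`Spacetime` (smooth metric) — no `SubconvergesLocallyTo` limit is produced, and none can be in general
(vacuum pp-waves with profiles bounded in `C³` and unbounded in `C⁴` have no smooth `C³_loc` limit). So
stub A over `DevHyp` as typed contains the a-priori late-time regularity upgrade of tame vacuum exteriors.

What this file does NOT give (recorded for the lead, `work/stubs/stub_silentHull.md`): the limit produced
here lives on ONE coordinate ball `B(0, r₀)` (`SubconvergesLocallyTo` has no covering clause, so it is a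
legitimate limit), and a ball carries no eternal far cylinder, hence no `EndDatum` in any tame class. The
hull elements of stub A are limits on EXHAUSTING domains, which need the tame balls of (ii) to be glued
coherently along the sequence (uniform transition control between overlapping balls — a non-collapse /
no-boost coherence that the boost-blind hypothesis (ii) does not supply, `Negative/TameChartsBoostBlind`),
plus a uniform eternal far chart; those, the clock, and silence are the remaining (open) content of A.

References: Petersen 2006, Ch. 10 §3.2 (pointed convergence, Lemma 74); Anderson 2004, §1 and §5
(Cheeger–Gromov limits in general relativity; vacuum passes to limits).
-/

noncomputable section

-- the operator-norm instance on `E4 →L[ℝ] E4 →L[ℝ] ℝ` needs one more level of pending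
-- instance problems than the default (as in `PhotonSphereChannelsTameHullDefs.lean`)
set_option maxSynthPendingDepth 3
-- every `Summit.FinalStateConjecture.FinalStateConjecture.…` name repeats the summit = sub-problem segment (D-0017 layout)
set_option linter.dupNamespace false

open Set Filter Function TopologicalSpace Manifold Bundle
open scoped Topology Manifold ContDiff ENNReal NNReal

namespace Summit.FinalStateConjecture.FinalStateConjecture.Theorems.DarkFuture

open Literature.Geometry.Lorentzian
open Summit.FinalStateConjecture.FinalStateConjecture.Theorems.TameHull

section Limits

variable {X : Type} [TopologicalSpace X] [ChartedSpace E3 X] [IsManifold (𝓡 3) ∞ X]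
  [T2Space X] [SecondCountableTopology X] [ConnectedSpace X] {D : InitialDataSet (𝓡 3) X}

omit [T2Space X] [SecondCountableTopology X] in
/-- **Compactness third of stub A, chart level.** Let `S ⊆ 𝒟` be a region of a vacuum Cauchy development
every point of which is the centre of a late chart of the Minkowski background on `B(0, r₀)` with
`C⁰`-deviation `≤ 1/2` and `Cᵏ`-deviation `≤ Λ k` for every `k` (hypothesis (ii) of the crux at all
orders, per point, verbatim). Then along every sequence `q` in `S` there is a near-Minkowski field `G` on the
ball — `‖G − η‖ ≤ 1/2`, `sup_{Cᵏ}‖G − η‖ ≤ Λ k`, RICCI-FLAT — such that `(𝒟, qₙ)` subconverges in the pointed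
`Cᵏ_loc` sense, for every `k`, to the chart spacetime `(B(0, r₀), G)` based at `0`, time-oriented by `∂₀` or
by `−∂₀`. Local Cheeger–Gromov compactness (`exists_nearMinkowskiChart_subconvergesLocallyTo_of_isLateChart_unoriented`)
plus "vacuum passes to `C²` limits" (`Spacetime.ricAt_eq_zero_of_tendsto_metricInCoords`).
[cite: Petersen2006, Ch. 10 §3.2] [cite: Anderson2004, Def. 1.1 and Thm 5.1] -/
theorem exists_nearMinkowskiChart_limit_of_tameAllOrders (𝒟 : VacuumCauchyDevelopment D)
    {S : Set 𝒟.carrier} {r₀ : ℝ} (hr₀ : 0 < r₀) (Λ : ℕ → ℝ≥0)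
    (htame : ∀ q ∈ S,
      let U : Opens E4 := ⟨Metric.ball (0 : E4) r₀, Metric.isOpen_ball⟩
      ∃ Ψ : U → 𝒟.carrier, 𝒟.toSpacetime.IsLateChart (Minkowski.backgroundOn U) Set.univ (-r₀) Ψ ∧
        (∃ x : U, (x : E4) = 0 ∧ Ψ x = q) ∧
        supCkENorm (U : Set E4) 0 (𝒟.toSpacetime.deviationExtend (Minkowski.backgroundOn U) Ψ) ≤ 1 / 2 ∧
        ∀ k : ℕ, supCkENorm (U : Set E4) k
          (𝒟.toSpacetime.deviationExtend (Minkowski.backgroundOn U) Ψ) ≤ (Λ k : ℝ≥0∞))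
    (q : ℕ → 𝒟.carrier) (hq : ∀ n, q n ∈ S) :
    ∃ L : NearMinkowskiChart (⟨Metric.ball (0 : E4) r₀, Metric.isOpen_ball⟩ : Opens E4),
      (∀ y ∈ Metric.ball (0 : E4) r₀, ‖L.G y - Minkowski.bilin‖ ≤ 1 / 2) ∧
      (∀ k : ℕ, supCkENorm (Metric.ball (0 : E4) r₀) k (L.G - fun _ ↦ Minkowski.bilin) ≤ (Λ k : ℝ≥0∞)) ∧
      (∀ [L.metric.toPseudoRiemannianMetric.HasLeviCivita], L.metric.toPseudoRiemannianMetric.IsRicciFlat) ∧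
      ((∀ k : ℕ, Spacetime.SubconvergesLocallyTo (fun _ ↦ 𝒟.toSpacetime) q
          (L.spacetime (isConnected_ball_E4 hr₀)) ⟨0, Metric.mem_ball_self hr₀⟩ k) ∨
        (∀ k : ℕ, Spacetime.SubconvergesLocallyTo (fun _ ↦ 𝒟.toSpacetime) q
          (L.spacetimeRev (isConnected_ball_E4 hr₀)) ⟨0, Metric.mem_ball_self hr₀⟩ k)) := by
  set U : Opens E4 := ⟨Metric.ball (0 : E4) r₀, Metric.isOpen_ball⟩ with hU
  -- one tame chart per index
  choose Ψ hΨ using fun n ↦ htame (q n) (hq n)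
  have hlate : ∀ n, 𝒟.toSpacetime.IsLateChart (Minkowski.backgroundOn U) Set.univ (-r₀) (Ψ n) :=
    fun n ↦ (hΨ n).1
  have hsmooth : ∀ n, ContMDiff 𝓘(ℝ, E4) (𝓡 4) ∞ (Ψ n) := fun n ↦ (hlate n).contMDiff
  have hcentre : ∀ n, Ψ n ⟨0, Metric.mem_ball_self hr₀⟩ = q n := fun n ↦ by
    obtain ⟨x, hx0, hxq⟩ := (hΨ n).2.1
    have hx : (⟨0, Metric.mem_ball_self hr₀⟩ : U) = x := Subtype.ext hx0.symm
    rw [hx]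
    exact hxq
  have hpinch : ∀ n, supCkENorm (Metric.ball (0 : E4) r₀) 0
      (𝒟.toSpacetime.deviationExtend (Minkowski.backgroundOn U) (Ψ n)) ≤ 1 / 2 := fun n ↦ (hΨ n).2.2.1
  have hbound : ∀ k : ℕ, ∃ Λ' : ℝ≥0, ∀ n, supCkENorm (Metric.ball (0 : E4) r₀) k
      (𝒟.toSpacetime.deviationExtend (Minkowski.backgroundOn U) (Ψ n)) ≤ Λ' :=
    fun k ↦ ⟨Λ k, fun n ↦ (hΨ n).2.2.2 k⟩
  -- pointwise pinching `< 1` (from the `C⁰` bound `≤ 1/2`)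
  have h12 : ((1 : ℝ≥0∞) / 2).toReal = 1 / 2 := by
    rw [ENNReal.toReal_div]; simp
  have hpinch' : ∀ n, ∀ y ∈ (U : Set E4),
      ‖𝒟.toSpacetime.deviationExtend (Minkowski.backgroundOn U) (Ψ n) y‖ < 1 := fun n y hy ↦ by
    have h := norm_le_of_supCkENorm_zero_le (by simp) (hpinch n) hy
    rw [h12] at h
    linarith
  -- local Cheeger–Gromov compactness, no orientation hypothesis
  obtain ⟨L, φ, -, h1, h2, h3, h4⟩ :=
    Spacetime.exists_nearMinkowskiChart_subconvergesLocallyTo_of_isLateChart_unoriented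
      (𝓢ₙ := fun _ ↦ 𝒟.toSpacetime) (pₙ := q) hr₀ Ψ (𝒟 := fun _ ↦ Set.univ) hlate hcentre hpinch hbound
  -- vacuum passes to the `C²` limit: `ricAt G = 0` on the ball
  have hric : ∀ y ∈ (U : Set E4), MetricCoord.ricAt L.G y = 0 := fun y hy ↦
    Spacetime.ricAt_eq_zero_of_tendsto_metricInCoords (𝓢ₙ := fun _ ↦ 𝒟.toSpacetime) Ψ hsmooth
      (fun n ↦ 𝒟.toSpacetime.injective_mfderiv_of_norm_deviationExtend_lt_one (Ψ n) (hsmooth n)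
        (hpinch' n))
      (fun _ ↦ 𝒟.isRicciFlat) L.contDiffOn L.isMetricOn (φ := φ) ⟨0, Metric.mem_ball_self hr₀⟩
      (fun z hz ↦ Spacetime.tendsto_supCkENorm_metricInCoords_sub_of_deviationExtend
        (𝓢ₙ := fun _ ↦ 𝒟.toSpacetime) Ψ hsmooth ⟨0, Metric.mem_ball_self hr₀⟩ L.G
        (singleton_subset_iff.2 hz) (h3 2 {z} (singleton_subset_iff.2 hz) isCompact_singleton))
      hy
  refine ⟨L, h1, fun k ↦ h2 k (Λ k) fun n ↦ (hΨ n).2.2.2 k, ?_, h4⟩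
  intro _
  exact L.isRicciFlat_metric_of_ricAt_eq_zero hric

omit [T2Space X] [SecondCountableTopology X] in
/-- **Compactness third of stub A, packaged: vacuum limits exist along every sequence of an all-orders tame
region.** Under the hypotheses of `exists_nearMinkowskiChart_limit_of_tameAllOrders`, for every sequence `q`
in `S` there are a spacetime `𝓢` and a base point `p` with `Ric(𝓢) = 0` and `(𝒟, qₙ) ⇀ (𝓢, p)` in the
pointed `Cᵏ_loc` sense for EVERY `k` (in particular the `k = 2` clause of `TameHull.IsHullElement` /
`IsSilentHullElement`). [cite: Anderson2004, Def. 1.1 and Thm 5.1] -/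
theorem exists_vacuumLimit_of_tameAllOrders (𝒟 : VacuumCauchyDevelopment D)
    {S : Set 𝒟.carrier} {r₀ : ℝ} (hr₀ : 0 < r₀) (Λ : ℕ → ℝ≥0)
    (htame : ∀ q ∈ S,
      let U : Opens E4 := ⟨Metric.ball (0 : E4) r₀, Metric.isOpen_ball⟩
      ∃ Ψ : U → 𝒟.carrier, 𝒟.toSpacetime.IsLateChart (Minkowski.backgroundOn U) Set.univ (-r₀) Ψ ∧
        (∃ x : U, (x : E4) = 0 ∧ Ψ x = q) ∧
        supCkENorm (U : Set E4) 0 (𝒟.toSpacetime.deviationExtend (Minkowski.backgroundOn U) Ψ) ≤ 1 / 2 ∧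
        ∀ k : ℕ, supCkENorm (U : Set E4) k
          (𝒟.toSpacetime.deviationExtend (Minkowski.backgroundOn U) Ψ) ≤ (Λ k : ℝ≥0∞))
    (q : ℕ → 𝒟.carrier) (hq : ∀ n, q n ∈ S) :
    ∃ (𝓢 : Spacetime.{0} 4) (p : 𝓢.carrier),
      (∀ [𝓢.metric.toPseudoRiemannianMetric.HasLeviCivita],
        𝓢.metric.toPseudoRiemannianMetric.IsRicciFlat) ∧
      ∀ k : ℕ, Spacetime.SubconvergesLocallyTo (fun _ ↦ 𝒟.toSpacetime) q 𝓢 p k := by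
  obtain ⟨L, -, -, hvac, h | h⟩ := exists_nearMinkowskiChart_limit_of_tameAllOrders 𝒟 hr₀ Λ htame q hq
  · refine ⟨L.spacetime (isConnected_ball_E4 hr₀), ⟨0, Metric.mem_ball_self hr₀⟩, ?_, h⟩
    intro inst
    haveI : L.metric.toPseudoRiemannianMetric.HasLeviCivita := inst
    exact hvac
  · refine ⟨L.spacetimeRev (isConnected_ball_E4 hr₀), ⟨0, Metric.mem_ball_self hr₀⟩, ?_, h⟩
    intro inst
    haveI : L.metric.toPseudoRiemannianMetric.HasLeviCivita := inst
    exact hvac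

/-- **The limit clause of `IsSilentHullElement` under the all-orders form of hypothesis (ii).** If the
outer region `outerRegion 𝒟` of a vacuum development is all-orders tame (every outer point is the centre
of a late chart of `B(0, r₀)` with `C⁰`-deviation `≤ 1/2` and `Cᵏ`-deviation `≤ Λ k`, every `k`), then along
every future-escaping outer sequence `q` (`TameHull.IsFutureEscaping`) there are a VACUUM spacetime `𝓢` and
a base point `p` with `(𝒟, qₙ) ⇀ (𝓢, p)` in the pointed `Cᵏ_loc` sense for every `k` — the convergence
clause of a hull element along `q`; the end datum on the limit (eternal far chart, clock, all-orders tame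
class) and its silence are the remaining content of stub A. [cite: Anderson2004, Def. 1.1 and Thm 5.1] -/
theorem exists_vacuumLimit_of_isFutureEscaping : ∀ {X : Type} [TopologicalSpace X] [ChartedSpace E3 X] [IsManifold (𝓡 3) ∞ X] [ConnectedSpace X] {D : InitialDataSet (𝓡 3) X} (𝒟 : VacuumCauchyDevelopment D) [𝒟.metric.HasLeviCivita] {r₀ : ℝ}, 0 < r₀ → ∀ (Λ : ℕ → ℝ≥0), (∀ q ∈ outerRegion 𝒟, ∃ Ψ : (⟨Metric.ball (0 : E4) r₀, Metric.isOpen_ball⟩ : Opens E4) → 𝒟.carrier, 𝒟.toSpacetime.IsLateChart (Minkowski.backgroundOn ⟨Metric.ball (0 : E4) r₀, Metric.isOpen_ball⟩) Set.univ (-r₀) Ψ ∧ (∃ x : (⟨Metric.ball (0 : E4) r₀, Metric.isOpen_ball⟩ : Opens E4), (x : E4) = 0 ∧ Ψ x = q) ∧ supCkENorm (Metric.ball (0 : E4) r₀) 0 (𝒟.toSpacetime.deviationExtend (Minkowski.backgroundOn ⟨Metric.ball (0 : E4) r₀, Metric.isOpen_ball⟩) Ψ) ≤ 1 / 2 ∧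 ∀ k : ℕ, supCkENorm (Metric.ball (0 : E4) r₀) k (𝒟.toSpacetime.deviationExtend (Minkowski.backgroundOn ⟨Metric.ball (0 : E4) r₀, Metric.isOpen_ball⟩) Ψ) ≤ ((Λ k : ℝ≥0) : ℝ≥0∞)) → ∀ {q : ℕ → 𝒟.carrier}, IsFutureEscaping 𝒟 q → ∃ (𝓢 : Spacetime.{0} 4) (p : 𝓢.carrier), (∀ [𝓢.metric.toPseudoRiemannianMetric.HasLeviCivita], 𝓢.metric.toPseudoRiemannianMetric.IsRicciFlat) ∧ ∀ k : ℕ, Spacetime.SubconvergesLocallyTo (fun _ ↦ 𝒟.toSpacetime) q 𝓢 p k :=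
  fun 𝒟 _ _ hr₀ Λ htame _ hq ↦ exists_vacuumLimit_of_tameAllOrders 𝒟 hr₀ Λ htame _ hq.1

end Limits

end Summit.FinalStateConjecture.FinalStateConjecture.Theorems.DarkFuture

end
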